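import Literature.Computability.Complexity.GateEliminationCascade

/-!
# Gate elimination: syntactically constant nodes, doomed gates, and the generalized cascade

Counting tool for "at least `r` gates are eliminated by Rule 2 and Rule 3" (Li–Yang §4.1,
Cases 1, 3, 5–8): a node is *syntactically constant* (`SynVal`) if it is a constant, or a gate
whose function is constant once its syntactically constant wires are fixed to their values
("trivialized … its descendants are degenerated", Case 3); a gate is *doomed* if it reads a
syntactically constant node. Doomed gates other than the eliminated one stay doomed along the
eliminations of Rules 2/3 (`ElimDataD`), a doomed circuit has a gate fed by a constant, hence
`r ≤ #doomed` gates can be eliminated with `Δμ ≥ 1 - α_φ` each (`cascade_doomed`).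

## References

* J. Li, T. Yang, *3.1n − o(n) circuit lower bounds for explicit functions*, STOC 2022;
  ECCC TR21-023, §3.3 (Rules 2, 3), Lemma 3.11, §4.1 (Cases 1, 3).
-/

namespace Literature.Computability.Complexity

open Finset

namespace Semicircuit

variable {n : ℕ}

/-! ### Syntactically constant nodes -/

/-- **Syntactic constancy** of a node with value `b`: a constant node; or a gate one of whose
wires is syntactically constant with a value making the gate's function constant (a
*trivialized* gate, Rule 2), or both of whose wires are syntactically constant (Li–Yang §4.1,
Case 3: "if a gate is fed by both `G` and `x` …, it is then trivialized and its descendants are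
degenerated"). [cite: LiYang2022, §3.3 (Rule 2), §4.1 (Case 3)] -/
inductive SynVal (D : Semicircuit n) : Node n D.m → Bool → Prop
  /-- a constant node -/
  | const (b : Bool) : SynVal D (.const b) b
  /-- the first wire is syntactically constant and fixes the value -/
  | left {k : Fin D.m} {c b : Bool} : SynVal D (D.arg k 0) c → (∀ q, D.op k c q = b) → SynVal D (.gate k) b
  /-- the second wire is syntactically constant and fixes the value -/
  | right {k : Fin D.m} {c b : Bool} : SynVal D (D.arg k 1) c → (∀ p, D.op k p c = b) → SynVal D (.gate k) b
  /-- both wires are syntactically constant -/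
  | both {k : Fin D.m} {c₀ c₁ b : Bool} : SynVal D (D.arg k 0) c₀ → SynVal D (D.arg k 1) c₁ → D.op k c₀ c₁ = b →
      SynVal D (.gate k) b

namespace SynVal

variable {D : Semicircuit n}

/-- **Soundness**: a syntactically constant node has that value under every consistent
assignment. [folklore] -/
theorem nodeVal_eq {u : Node n D.m} {b : Bool} (h : D.SynVal u b) {x : Fin n → Bool} {w : Fin D.m → Bool}
    (hw : D.Consistent x w) : D.nodeVal x w u = b := by
  induction h with
  | const b => rfl
  | left h0 hop ih => show w _ = _; rw [hw, ih, hop]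
  | right h1 hop ih => show w _ = _; rw [hw, ih, hop]
  | both h0 h1 hop ih0 ih1 => show w _ = _; rw [hw, ih0, ih1, hop]

/-- The value of a constant node. [folklore] -/
theorem eq_of_const {c b : Bool} (h : D.SynVal (.const c) b) : b = c := by
  cases h; rfl

/-- A variable is not syntactically constant. [folklore] -/
theorem not_var {i : Fin n} {b : Bool} (h : D.SynVal (.var i) b) : False := by
  cases h

/-- The value is unique as soon as the gate equations are solvable for some input (e.g. `D`
fair). [folklore] -/
theorem unique {u : Node n D.m} {b b' : Bool} (h : D.SynVal u b) (h' : D.SynVal u b')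
    (hex : ∃ (x : Fin n → Bool) (w : Fin D.m → Bool), D.Consistent x w) : b = b' := by
  obtain ⟨x, w, hw⟩ := hex
  rw [← h.nodeVal_eq hw, ← h'.nodeVal_eq hw]

/-- A syntactically constant gate reads a syntactically constant node. [folklore] -/
theorem exists_wire {k : Fin D.m} {b : Bool} (h : D.SynVal (.gate k) b) : ∃ a c, D.SynVal (D.arg k a) c := by
  cases h with
  | left h0 _ => exact ⟨0, _, h0⟩
  | right h1 _ => exact ⟨1, _, h1⟩
  | both h0 _ _ => exact ⟨0, _, h0⟩

/-- Below a syntactically constant node there is a constant wire (or the node is a constant).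
[folklore] -/
theorem exists_const_wire {u : Node n D.m} {b : Bool} (h : D.SynVal u b) :
    (∃ c, u = .const c) ∨ ∃ (k : Fin D.m) (a : Fin 2) (c : Bool), D.arg k a = .const c := by
  induction h with
  | const b => exact Or.inl ⟨b, rfl⟩
  | @left k c _ h0 _ ih =>
    rcases ih with ⟨c', hc'⟩ | h
    · exact Or.inr ⟨k, 0, c', hc'⟩
    · exact Or.inr h
  | @right k c _ h1 _ ih =>
    rcases ih with ⟨c', hc'⟩ | h
    · exact Or.inr ⟨k, 1, c', hc'⟩
    · exact Or.inr h
  | @both k c₀ _ _ h0 _ _ ih0 _ =>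
    rcases ih0 with ⟨c', hc'⟩ | h
    · exact Or.inr ⟨k, 0, c', hc'⟩
    · exact Or.inr h

end SynVal

/-! ### Doomed gates -/

open Classical in
/-- The **doomed** gates: those reading a syntactically constant node (they will be eliminated by
Rules 2/3, possibly after the gates below them). [cite: LiYang2022, §4.1 (Case 3)] -/
noncomputable def doomed (D : Semicircuit n) : Finset (Fin D.m) :=
  univ.filter fun k => ∃ (a : Fin 2) (b : Bool), D.SynVal (D.arg k a) b

variable (D : Semicircuit n)

/-- Membership in the doomed set. [folklore] -/
theorem mem_doomed_iff {k : Fin D.m} : k ∈ D.doomed ↔ ∃ (a : Fin 2) (b : Bool), D.SynVal (D.arg k a) b := by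
  classical
  unfold doomed
  rw [mem_filter]
  simp only [mem_univ, true_and]

/-- A gate fed by a constant is doomed. [folklore] -/
theorem mem_doomed_of_const {k : Fin D.m} {a : Fin 2} {c : Bool} (h : D.arg k a = .const c) : k ∈ D.doomed :=
  D.mem_doomed_iff.mpr ⟨a, c, h ▸ SynVal.const c⟩

/-- A syntactically constant gate is doomed. [folklore] -/
theorem mem_doomed_of_synVal {k : Fin D.m} {b : Bool} (h : D.SynVal (.gate k) b) : k ∈ D.doomed :=
  D.mem_doomed_iff.mpr h.exists_wire

/-- A reader of a syntactically constant gate is doomed. [folklore] -/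
theorem mem_doomed_of_reads {k k' : Fin D.m} {a : Fin 2} (h : D.arg k a = .gate k') {b : Bool}
    (h' : D.SynVal (.gate k') b) : k ∈ D.doomed :=
  D.mem_doomed_iff.mpr ⟨a, b, h ▸ h'⟩

/-- The gates fed by a constant are doomed. [folklore] -/
theorem constFedCount_le_card_doomed : D.constFedCount ≤ D.doomed.card := by
  classical
  unfold constFedCount
  refine card_le_card fun k hk => ?_
  obtain ⟨a, c, h⟩ := (mem_filter.mp hk).2
  exact D.mem_doomed_of_const h

/-- **A doomed circuit has a gate fed by a constant.** [folklore] -/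
theorem constFedCount_pos_of_doomed_nonempty (h : D.doomed.Nonempty) : 0 < D.constFedCount := by
  classical
  obtain ⟨k, hk⟩ := h
  obtain ⟨a, b, hs⟩ := D.mem_doomed_iff.mp hk
  unfold constFedCount
  rw [card_pos]
  rcases hs.exists_const_wire with ⟨c, hc⟩ | ⟨k', a', c, hc⟩
  · exact ⟨k, mem_filter.mpr ⟨mem_univ _, a, c, hc⟩⟩
  · exact ⟨k', mem_filter.mpr ⟨mem_univ _, a', c, hc⟩⟩

/-! ### Transport of syntactic constancy along the surgery primitives -/

variable {D}
variable (C : Semicircuit n)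

/-- Moving the output does not affect syntactic constancy. [folklore] -/
theorem SynVal.of_setOut (v : Node n C.m) {u : Node n (C.setOut v).m} {b : Bool} (h : (C.setOut v).SynVal u b) :
    C.SynVal u b := by
  induction h with
  | const b => exact .const b
  | left _ hop ih => exact .left ih hop
  | right _ hop ih => exact .right ih hop
  | both _ _ hop ih0 ih1 => exact .both ih0 ih1 hop

/-- Moving the output does not affect syntactic constancy. [folklore] -/
theorem SynVal.setOut (v : Node n C.m) {u : Node n C.m} {b : Bool} (h : C.SynVal u b) : (C.setOut v).SynVal u b := by
  induction h with
  | const b => exact .const b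
  | left _ hop ih => exact .left ih hop
  | right _ hop ih => exact .right ih hop
  | both _ _ hop ih0 ih1 => exact .both ih0 ih1 hop

/-- The doomed set is unchanged by moving the output. [folklore] -/
theorem doomed_setOut (v : Node n C.m) : (C.setOut v).doomed = C.doomed := by
  ext k
  rw [mem_doomed_iff, mem_doomed_iff]
  exact ⟨fun ⟨a, b, h⟩ => ⟨a, b, h.of_setOut C v⟩, fun ⟨a, b, h⟩ => ⟨a, b, h.setOut C v⟩⟩

/-- The function of a gate after flipping `k₁`. [folklore] -/
theorem flipGate_op_eq (k₁ k : Fin C.m) (p q : Bool) : (C.flipGate k₁).op k p q =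
    (C.op k (p ^^ decide (C.arg k 0 = .gate k₁)) (q ^^ decide (C.arg k 1 = .gate k₁)) ^^ decide (k = k₁)) := by
  show (let r := C.op k (p ^^ decide (C.arg k 0 = .gate k₁)) (q ^^ decide (C.arg k 1 = .gate k₁)); if k = k₁ then !r else r) = _
  by_cases hk : k = k₁
  · simp only [hk, if_true, decide_true, Bool.xor_true]
  · simp only [hk, if_false, decide_false, Bool.xor_false]

/-- **Flipping a gate** keeps syntactic constancy, negating the value at the flipped gate. [folklore] -/
theorem SynVal.flipGate (k₁ : Fin C.m) {u : Node n C.m} {b : Bool} (h : C.SynVal u b) :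
    (C.flipGate k₁).SynVal u (b ^^ decide (u = .gate k₁)) := by
  have hxx : ∀ (c : Bool) (d : Bool), ((c ^^ d) ^^ d) = c := by decide
  have hgate : ∀ k : Fin C.m, decide ((Node.gate k : Node n C.m) = .gate k₁) = decide (k = k₁) := fun k => by
    by_cases hk : k = k₁
    · rw [decide_eq_true hk, decide_eq_true (congrArg Node.gate hk)]
    · rw [decide_eq_false hk, decide_eq_false (fun h => hk (Node.gate.inj h))]
  induction h with
  | const b =>
    rw [decide_eq_false (fun h => by cases h), Bool.xor_false]; exact .const b
  | @left k c b h0 hop ih =>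
    refine .left ih fun q => ?_
    rw [flipGate_op_eq, hxx, hop, hgate]
  | @right k c b h1 hop ih =>
    refine .right ih fun p => ?_
    rw [flipGate_op_eq, hxx, hop, hgate]
  | @both k c₀ c₁ b h0 h1 hop ih0 ih1 =>
    refine .both ih0 ih1 ?_
    rw [flipGate_op_eq, hxx, hxx, hop, hgate]

/-- The doomed set is unchanged by flipping a gate. [folklore] -/
theorem doomed_subset_doomed_flipGate (k₁ : Fin C.m) : C.doomed ⊆ (C.flipGate k₁).doomed := by
  intro k hk
  obtain ⟨a, b, h⟩ := C.mem_doomed_iff.mp hk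
  exact (C.flipGate k₁).mem_doomed_iff.mpr ⟨a, _, h.flipGate C k₁⟩

section RemoveGate

variable (k₀ : Fin C.m) {m' : ℕ} (ε : Fin m' ≃ {k : Fin C.m // k ≠ k₀})

/-- **Deleting an unread gate** keeps syntactic constancy of the other nodes. [folklore] -/
theorem SynVal.removeGate (h0 : ∀ k a, C.arg k a ≠ .gate k₀) {u : Node n C.m} {b : Bool} (h : C.SynVal u b)
    (hu : u ≠ .gate k₀) : (C.removeGate k₀ ε).SynVal (u.skip k₀ ε) b := by
  induction h with
  | const b => exact .const b
  | @left k c b h0' hop ih =>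
    have hk : k ≠ k₀ := fun h => hu (congrArg Node.gate h)
    rw [Node.skip_gate_of_ne k₀ ε hk]
    refine .left (c := c) ?_ fun q => ?_
    · rw [removeGate_arg]; simpa using ih (h0 k 0)
    · show C.op (ε (ε.symm ⟨k, hk⟩)) c q = b; simpa using hop q
  | @right k c b h1' hop ih =>
    have hk : k ≠ k₀ := fun h => hu (congrArg Node.gate h)
    rw [Node.skip_gate_of_ne k₀ ε hk]
    refine .right (c := c) ?_ fun p => ?_
    · rw [removeGate_arg]; simpa using ih (h0 k 1)
    · show C.op (ε (ε.symm ⟨k, hk⟩)) p c = b; simpa using hop p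
  | @both k c₀ c₁ b h0' h1' hop ih0 ih1 =>
    have hk : k ≠ k₀ := fun h => hu (congrArg Node.gate h)
    rw [Node.skip_gate_of_ne k₀ ε hk]
    refine .both (c₀ := c₀) (c₁ := c₁) ?_ ?_ ?_
    · rw [removeGate_arg]; simpa using ih0 (h0 k 0)
    · rw [removeGate_arg]; simpa using ih1 (h0 k 1)
    · show C.op (ε (ε.symm ⟨k, hk⟩)) c₀ c₁ = b; simpa using hop

/-- Doomed gates survive the deletion of an unread gate. [folklore] -/
theorem mem_doomed_removeGate (h0 : ∀ k a, C.arg k a ≠ .gate k₀) {k : Fin m'} (hk : (ε k : Fin C.m) ∈ C.doomed) :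
    k ∈ (C.removeGate k₀ ε).doomed := by
  obtain ⟨a, b, h⟩ := C.mem_doomed_iff.mp hk
  refine (C.removeGate k₀ ε).mem_doomed_iff.mpr ⟨a, b, ?_⟩
  rw [removeGate_arg]
  exact h.removeGate C k₀ ε h0 (h0 _ a)

end RemoveGate

section RedirectConst

variable (k₀ : Fin C.m) (c : Bool)

/-- **Redirecting the readers of a gate of syntactic value `c` to the constant `c`** keeps
syntactic constancy. [folklore] -/
theorem SynVal.redirect_const (hk₀ : ∀ b, C.SynVal (.gate k₀) b → b = c) {u : Node n C.m} {b : Bool}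
    (h : C.SynVal u b) : (C.redirect k₀ (.const c) false (C.redirectOK_const k₀ c)).SynVal u b := by
  have harg : ∀ k a, (C.redirect k₀ (.const c) false (C.redirectOK_const k₀ c)).arg k a =
      if C.arg k a = .gate k₀ then .const c else C.arg k a := fun _ _ => rfl
  have hop' : ∀ k p q, (C.redirect k₀ (.const c) false (C.redirectOK_const k₀ c)).op k p q = C.op k p q := by
    intro k p q
    show C.op k (p ^^ (false && _)) (q ^^ (false && _)) = _
    rw [Bool.false_and, Bool.false_and, Bool.xor_false, Bool.xor_false]
  -- a transported wire
  have hw : ∀ (k : Fin C.m) (a : Fin 2) (c' : Bool), C.SynVal (C.arg k a) c' →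
      (C.redirect k₀ (.const c) false (C.redirectOK_const k₀ c)).SynVal (C.arg k a) c' →
      (C.redirect k₀ (.const c) false (C.redirectOK_const k₀ c)).SynVal
        ((C.redirect k₀ (.const c) false (C.redirectOK_const k₀ c)).arg k a) c' := by
    intro k a c' hc ih
    rw [harg]
    by_cases hr : C.arg k a = .gate k₀
    · rw [if_pos hr, ← hk₀ c' (hr ▸ hc)]; exact .const c'
    · rw [if_neg hr]; exact ih
  induction h with
  | const b => exact .const b
  | @left k c' b h0 hop ih => exact .left (hw k 0 c' h0 ih) fun q => by rw [hop']; exact hop q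
  | @right k c' b h1 hop ih => exact .right (hw k 1 c' h1 ih) fun p => by rw [hop']; exact hop p
  | @both k c₀ c₁ b h0 h1 hop ih0 ih1 => exact .both (hw k 0 c₀ h0 ih0) (hw k 1 c₁ h1 ih1) (by rw [hop']; exact hop)

/-- After redirecting to the constant, the readers of `k₀` are fed by a constant, and doomed
gates stay doomed. [folklore] -/
theorem mem_doomed_redirect_const (hk₀ : ∀ b, C.SynVal (.gate k₀) b → b = c) {k : Fin C.m} (hk : k ∈ C.doomed) :
    k ∈ (C.redirect k₀ (.const c) false (C.redirectOK_const k₀ c)).doomed := by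
  obtain ⟨a, b, h⟩ := C.mem_doomed_iff.mp hk
  refine (C.redirect k₀ (.const c) false _).mem_doomed_iff.mpr ⟨a, ?_⟩
  have harg : (C.redirect k₀ (.const c) false (C.redirectOK_const k₀ c)).arg k a =
      if C.arg k a = .gate k₀ then .const c else C.arg k a := rfl
  rw [harg]
  by_cases hr : C.arg k a = .gate k₀
  · rw [if_pos hr]; exact ⟨c, .const c⟩
  · rw [if_neg hr]; exact ⟨b, h.redirect_const C k₀ c hk₀⟩

/-- After redirecting to the constant, the readers of `k₀` are fed by a constant. [folklore] -/
theorem mem_doomed_redirect_const_of_reads {k : Fin C.m} {a : Fin 2} (hr : C.arg k a = .gate k₀) :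
    k ∈ (C.redirect k₀ (.const c) false (C.redirectOK_const k₀ c)).doomed := by
  refine (C.redirect k₀ (.const c) false _).mem_doomed_iff.mpr ⟨a, c, ?_⟩
  have harg : (C.redirect k₀ (.const c) false (C.redirectOK_const k₀ c)).arg k a =
      if C.arg k a = .gate k₀ then .const c else C.arg k a := rfl
  rw [harg, if_pos hr]; exact .const c

end RedirectConst

section RedirectLive

variable (k₀ : Fin C.m) (a₀ : Fin 2) (neg : Bool)

/-- **Redirecting the readers of a degenerate gate to its live input** keeps syntactic
constancy; moreover a syntactic value of `k₀` comes from a syntactic value of its live input.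
[folklore] -/
theorem SynVal.redirect_live {b₀ : Bool} (h₀ : C.arg k₀ a₀ = .const b₀)
    (hdeg : ∀ t, C.liveFn k₀ a₀ b₀ t = (t ^^ neg))
    {u : Node n C.m} {b : Bool} (h : C.SynVal u b) :
    (C.redirect k₀ (C.arg k₀ a₀.rev) neg (C.redirectOK_live k₀ a₀)).SynVal u b ∧
      (u = .gate k₀ →
        (C.redirect k₀ (C.arg k₀ a₀.rev) neg (C.redirectOK_live k₀ a₀)).SynVal (C.arg k₀ a₀.rev) (b ^^ neg)) := by
  have harg : ∀ k a, (C.redirect k₀ (C.arg k₀ a₀.rev) neg (C.redirectOK_live k₀ a₀)).arg k a =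
      if C.arg k a = .gate k₀ then C.arg k₀ a₀.rev else C.arg k a := fun _ _ => rfl
  have hop' : ∀ k p q, (C.redirect k₀ (C.arg k₀ a₀.rev) neg (C.redirectOK_live k₀ a₀)).op k p q =
      C.op k (p ^^ (neg && decide (C.arg k 0 = .gate k₀))) (q ^^ (neg && decide (C.arg k 1 = .gate k₀))) :=
    fun _ _ _ => rfl
  have hxx : ∀ c : Bool, ((c ^^ neg) ^^ (neg && true)) = c := fun c => by cases c <;> cases neg <;> rfl
  have hx0 : ∀ c : Bool, (c ^^ (neg && false)) = c := fun c => by cases c <;> cases neg <;> rfl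
  -- the value of `k₀` in terms of its live input
  have hk₀val : ∀ c b, C.liveFn k₀ a₀ b₀ c = b → (b ^^ neg) = c := by
    intro c b h
    rw [hdeg] at h
    rw [← h]; cases c <;> cases neg <;> rfl
  have hlf0 : ∀ p q, a₀ = 0 → C.liveFn k₀ a₀ p q = C.op k₀ p q := fun p q h => by
    unfold liveFn; rw [if_pos h]
  have hlf1 : ∀ p q, a₀ = 1 → C.liveFn k₀ a₀ p q = C.op k₀ q p := fun p q h => by
    unfold liveFn; rw [if_neg (by rw [h]; decide)]
  -- the constant wire of `k₀` cannot fix the value (degenerate, not trivialized)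
  have hk₀const : ∀ c b, C.SynVal (C.arg k₀ a₀) c →
      ¬ ((a₀ = 0 → ∀ q, C.op k₀ c q = b) ∧ (a₀ = 1 → ∀ p, C.op k₀ p c = b)) := by
    intro c b hc hops
    rw [h₀] at hc
    have hcb := hc.eq_of_const
    subst hcb
    have h1 : C.liveFn k₀ a₀ c false = C.liveFn k₀ a₀ c true := by
      unfold liveFn
      obtain rfl | rfl : a₀ = 0 ∨ a₀ = 1 := by fin_cases a₀ <;> simp
      · rw [if_pos rfl, if_pos rfl, hops.1 rfl, hops.1 rfl]
      · rw [if_neg (by decide), if_neg (by decide), hops.2 rfl, hops.2 rfl]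
    rw [hdeg, hdeg] at h1
    cases neg <;> simp at h1
  induction h with
  | const b => exact ⟨.const b, fun h => by cases h⟩
  | @left k c b hk0 hop ih =>
    refine ⟨?_, fun hk => ?_⟩
    · by_cases hr : C.arg k 0 = .gate k₀
      · refine .left (c := c ^^ neg) ?_ fun q => ?_
        · rw [harg, if_pos hr]; exact ih.2 hr
        · rw [hop', decide_eq_true hr, hxx]; exact hop _
      · refine .left (c := c) ?_ fun q => ?_
        · rw [harg, if_neg hr]; exact ih.1
        · rw [hop', decide_eq_false hr, hx0]; exact hop _
    · cases hk
      by_cases ha : a₀ = 1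
      · subst ha
        have hc := hk₀val c b (by rw [hlf1 _ _ rfl]; exact hop _)
        rw [hc]; exact ih.1
      · have ha' : a₀ = 0 := by
          obtain rfl | rfl : a₀ = 0 ∨ a₀ = 1 := by fin_cases a₀ <;> simp
          · rfl
          · exact absurd rfl ha
        subst ha'
        exact absurd ⟨fun _ => hop, fun h => absurd h (by decide)⟩ (hk₀const c b hk0)
  | @right k c b hk1 hop ih =>
    refine ⟨?_, fun hk => ?_⟩
    · by_cases hr : C.arg k 1 = .gate k₀
      · refine .right (c := c ^^ neg) ?_ fun p => ?_
        · rw [harg, if_pos hr]; exact ih.2 hr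
        · rw [hop', decide_eq_true hr, hxx]; exact hop _
      · refine .right (c := c) ?_ fun p => ?_
        · rw [harg, if_neg hr]; exact ih.1
        · rw [hop', decide_eq_false hr, hx0]; exact hop _
    · cases hk
      by_cases ha : a₀ = 0
      · subst ha
        have hc := hk₀val c b (by rw [hlf0 _ _ rfl]; exact hop _)
        rw [hc]; exact ih.1
      · have ha' : a₀ = 1 := by
          obtain rfl | rfl : a₀ = 0 ∨ a₀ = 1 := by fin_cases a₀ <;> simp
          · exact absurd rfl ha
          · rfl
        subst ha'
        exact absurd ⟨fun h => absurd h (by decide), fun _ => hop⟩ (hk₀const c b hk1)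
  | @both k c₀ c₁ b hk0 hk1 hop ih0 ih1 =>
    refine ⟨?_, fun hk => ?_⟩
    · -- choose the transported values wire by wire
      have w0 : ∃ c₀', (C.redirect k₀ (C.arg k₀ a₀.rev) neg (C.redirectOK_live k₀ a₀)).SynVal
          ((C.redirect k₀ (C.arg k₀ a₀.rev) neg (C.redirectOK_live k₀ a₀)).arg k 0) c₀' ∧
          (c₀' ^^ (neg && decide (C.arg k 0 = .gate k₀))) = c₀ := by
        by_cases hr : C.arg k 0 = .gate k₀
        · exact ⟨c₀ ^^ neg, by rw [harg, if_pos hr]; exact ih0.2 hr, by rw [decide_eq_true hr, hxx]⟩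
        · exact ⟨c₀, by rw [harg, if_neg hr]; exact ih0.1, by rw [decide_eq_false hr, hx0]⟩
      have w1 : ∃ c₁', (C.redirect k₀ (C.arg k₀ a₀.rev) neg (C.redirectOK_live k₀ a₀)).SynVal
          ((C.redirect k₀ (C.arg k₀ a₀.rev) neg (C.redirectOK_live k₀ a₀)).arg k 1) c₁' ∧
          (c₁' ^^ (neg && decide (C.arg k 1 = .gate k₀))) = c₁ := by
        by_cases hr : C.arg k 1 = .gate k₀
        · exact ⟨c₁ ^^ neg, by rw [harg, if_pos hr]; exact ih1.2 hr, by rw [decide_eq_true hr, hxx]⟩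
        · exact ⟨c₁, by rw [harg, if_neg hr]; exact ih1.1, by rw [decide_eq_false hr, hx0]⟩
      obtain ⟨c₀', h0', e0⟩ := w0
      obtain ⟨c₁', h1', e1⟩ := w1
      exact .both h0' h1' (by rw [hop', e0, e1, hop])
    · cases hk
      obtain rfl | rfl : a₀ = 0 ∨ a₀ = 1 := by fin_cases a₀ <;> simp
      · -- constant at 0, live at 1
        have hc₀ : c₀ = b₀ := by rw [h₀] at hk0; exact hk0.eq_of_const
        subst hc₀
        have hc := hk₀val c₁ b (by rw [hlf0 _ _ rfl]; exact hop)
        rw [hc]; exact ih1.1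
      · -- live at 0, constant at 1
        have hc₁ : c₁ = b₀ := by rw [h₀] at hk1; exact hk1.eq_of_const
        subst hc₁
        have hc := hk₀val c₀ b (by rw [hlf1 _ _ rfl]; exact hop)
        rw [hc]; exact ih0.1

end RedirectLive

/-! ### The output is not syntactically constant -/

variable {C} in
/-- **The output node is not syntactically constant** when the circuit computes an affine
disperser for dimension `d` on a source of dimension `≥ 2d` (its value would be constant on
`Sol R`). [cite: LiYang2022, proof of Thm. 4.1 (§4.1)] -/
theorem not_synVal_out {f : (Fin n → ZMod 2) → Bool} {R : RdqSource n} {d : ℕ} (hf : IsAffineDisperser f d)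
    (hd : 2 * d ≤ R.dim) (hF : C.Fair) (hC : C.ComputesRestr f R) {b : Bool} (h : C.SynVal C.out b) : False := by
  obtain ⟨u, hu, v, hv, huv⟩ := hf.exists_ne_of_sol R hd
  have key : ∀ u ∈ R.Sol, f u = b := by
    intro u hu
    obtain ⟨w, hw, -⟩ := hF (boolOfZMod2.symm u)
    rw [← hC.2 u hu w hw, h.nodeVal_eq hw]
  exact huv ((key u hu).trans (key v hv).symm)

variable {C} in
/-- A doomed semicircuit computing an affine disperser: a syntactically constant gate is not the
output, hence (if `0`-gates are outputs) it is read by some gate, which is doomed. [folklore] -/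
theorem out_ne_of_synVal {f : (Fin n → ZMod 2) → Bool} {R : RdqSource n} {d : ℕ} (hf : IsAffineDisperser f d)
    (hd : 2 * d ≤ R.dim) (hF : C.Fair) (hC : C.ComputesRestr f R) {k : Fin C.m} {b : Bool}
    (h : C.SynVal (.gate k) b) : C.out ≠ .gate k := fun hout =>
  not_synVal_out hf hd hF hC (hout ▸ h)

/-! ### Elimination data transporting doomed gates -/

/-- **Elimination data along which doomed gates stay doomed** (and syntactically constant gates
stay syntactically constant): the bookkeeping for "at least `r` gates are eliminated by Rule 2
and Rule 3" when descendants are shared (Li–Yang §4.1, Case 3). [cite: LiYang2022, §4.1 (Case 3)] -/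
structure ElimDataD (C : Semicircuit n) (k₀ : Fin C.m) (f : (Fin n → ZMod 2) → Bool) (R : RdqSource n)
    (αφ αI αQ : ℝ) (P : Finset (Fin C.m × Fin C.m)) (δ : ℝ) extends ElimData C k₀ f R αφ αI αQ P δ where
  /-- doomed gates other than `k₀` stay doomed -/
  doomed_of : ∀ k', ι k' ∈ C.doomed → k' ∈ C'.doomed
  /-- syntactically constant gates other than `k₀` stay syntactically constant -/
  synVal_of : ∀ k' b, C.SynVal (.gate (ι k')) b → ∃ b', C'.SynVal (.gate k') b'
  /-- the readers of `k₀` become doomed if `k₀` was syntactically constant -/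
  doomed_of_reads : ∀ b, C.SynVal (.gate k₀) b → ∀ k' a, C.arg (ι k') a = .gate k₀ → k' ∈ C'.doomed

namespace ElimDataD

variable {C : Semicircuit n} {k₀ : Fin C.m} {f : (Fin n → ZMod 2) → Bool} {R : RdqSource n}
  {αφ αI αQ : ℝ} {P : Finset (Fin C.m × Fin C.m)} {δ δ' : ℝ}

/-- Weakening the measure bound. [folklore] -/
def mono (E : ElimDataD C k₀ f R αφ αI αQ P δ) (h : δ' ≤ δ) : ElimDataD C k₀ f R αφ αI αQ P δ' :=
  { E with measure_le := E.measure_le.trans (by linarith) }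

/-- Transport along `setOut`. [folklore] -/
def ofSetOut {v : Node n C.m} (E : ElimDataD (C.setOut v) k₀ f R αφ αI αQ P δ) : ElimDataD C k₀ f R αφ αI αQ P δ :=
  { E.toElimData.ofSetOut with
    doomed_of := fun k' hk => E.doomed_of k' (by rw [doomed_setOut]; exact hk)
    synVal_of := fun k' b h => E.synVal_of k' b (h.setOut C v)
    doomed_of_reads := fun b h k' a hr => E.doomed_of_reads b (h.setOut C v) k' a hr }

/-- Transport along `flipGate k₁`, `k₁ ≠ k₀`. [folklore] -/
def ofFlipGate {k₁ : Fin C.m} (E : ElimDataD (C.flipGate k₁) k₀ f R αφ αI αQ P δ) (hk : k₀ ≠ k₁) :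
    ElimDataD C k₀ f R αφ αI αQ P δ :=
  { E.toElimData.ofFlipGate hk with
    doomed_of := fun k' hk' => E.doomed_of k' (C.doomed_subset_doomed_flipGate k₁ hk')
    synVal_of := fun k' _ h => E.synVal_of k' _ (h.flipGate C k₁)
    doomed_of_reads := fun _ h k' a hr => E.doomed_of_reads _ (h.flipGate C k₁) k' a hr }

/-- **Doomed gates are not lost**: `#doomed(C) - 1 ≤ #doomed(C')`. [folklore] -/
theorem card_doomed_le (E : ElimDataD C k₀ f R αφ αI αQ P δ) : C.doomed.card ≤ E.C'.doomed.card + 1 := by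
  classical
  have hsub : C.doomed.erase k₀ ⊆ E.C'.doomed.image E.ι := by
    intro k hk
    rw [mem_erase] at hk
    obtain ⟨k', rfl⟩ := E.ι_surj k hk.1
    exact mem_image.mpr ⟨k', E.doomed_of k' hk.2, rfl⟩
  have h1 := card_le_card hsub
  have h2 : (E.C'.doomed.image E.ι).card ≤ E.C'.doomed.card := card_image_le
  have h3 := card_erase_add_one (s := C.doomed) (a := k₀)
  by_cases hk : k₀ ∈ C.doomed
  · rw [card_erase_of_mem hk] at h1
    have := card_pos.mpr ⟨k₀, hk⟩
    omega
  · rw [erase_eq_of_notMem hk] at h1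
    omega

/-- **Doomed gates after eliminating a syntactically constant gate**: the other doomed gates and
the readers of `k₀` are doomed in `C'`. [folklore] -/
theorem card_doomed_le_of_synVal (E : ElimDataD C k₀ f R αφ αI αQ P δ) {b : Bool} (hk₀ : C.SynVal (.gate k₀) b) :
    (univ.filter fun k => k ≠ k₀ ∧ (k ∈ C.doomed ∨ ∃ a, C.arg k a = .gate k₀)).card ≤ E.C'.doomed.card := by
  classical
  refine le_trans (card_le_card (t := E.C'.doomed.image E.ι) fun k hk => ?_) card_image_le
  rw [mem_filter] at hk
  obtain ⟨-, hk0, hk⟩ := hk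
  obtain ⟨k', rfl⟩ := E.ι_surj k hk0
  refine mem_image.mpr ⟨k', ?_, rfl⟩
  rcases hk with hk | ⟨a, ha⟩
  · exact E.doomed_of k' hk
  · exact E.doomed_of_reads b hk₀ k' a ha

end ElimDataD

/-! ### Producers -/

section Producers

variable {C : Semicircuit n} {k₀ : Fin C.m} {f : (Fin n → ZMod 2) → Bool} {R : RdqSource n} {αφ αI : ℝ}

/-- Doomed gates survive redirecting the readers of a degenerate gate to its live input. [folklore] -/
theorem mem_doomed_redirect_live (a₀ : Fin 2) (neg : Bool) {b₀ : Bool} (h₀ : C.arg k₀ a₀ = .const b₀)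
    (hdeg : ∀ t, C.liveFn k₀ a₀ b₀ t = (t ^^ neg)) {k : Fin C.m} (hk : k ∈ C.doomed) :
    k ∈ (C.redirect k₀ (C.arg k₀ a₀.rev) neg (C.redirectOK_live k₀ a₀)).doomed := by
  obtain ⟨a, b, h⟩ := C.mem_doomed_iff.mp hk
  refine (C.redirect k₀ _ neg _).mem_doomed_iff.mpr ⟨a, ?_⟩
  have harg : (C.redirect k₀ (C.arg k₀ a₀.rev) neg (C.redirectOK_live k₀ a₀)).arg k a =
      if C.arg k a = .gate k₀ then C.arg k₀ a₀.rev else C.arg k a := rfl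
  rw [harg]
  by_cases hr : C.arg k a = .gate k₀
  · rw [if_pos hr]; exact ⟨_, (SynVal.redirect_live C k₀ a₀ neg h₀ hdeg h).2 hr⟩
  · rw [if_neg hr]; exact ⟨b, (SynVal.redirect_live C k₀ a₀ neg h₀ hdeg h).1⟩

/-- **Elimination data (with doomed gates) for a trivialized gate** (Rule 2): `k₀` is fed by the
constant `b₀` at `a₀` and its live function is constant; its readers become fed by that constant.
[cite: LiYang2022, Lemma 3.11 (Rule 2)] -/
noncomputable def elimDataDTriv (hF : C.Fair) (hC : C.ComputesRestr f R)
    {P : Finset (Fin C.m × Fin C.m)} (hP : C.IsPacking P) {a₀ : Fin 2} {b₀ : Bool} (h₀ : C.arg k₀ a₀ = .const b₀)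
    (htriv : C.liveFn k₀ a₀ b₀ false = C.liveFn k₀ a₀ b₀ true) (hout : C.out ≠ .gate k₀)
    (hφ : 0 ≤ αφ) (hI : 0 ≤ αI) (αQ : ℝ) : ElimDataD C k₀ f R αφ αI αQ P (1 - αφ) := by
  have hself := hF.not_reads_self_of_const h₀
  have hk₀ : ¬ C.Troubled k₀ := not_troubled_of_reads_const h₀
  -- the value `c` of `k₀`
  let c := C.liveFn k₀ a₀ b₀ false
  have hlive : ∀ t, C.liveFn k₀ a₀ b₀ t = c := fun t => by cases t; exacts [rfl, htriv.symm]
  have hid : ∀ (x : Fin n → Bool) (w : Fin C.m → Bool),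
      C.op k₀ (C.nodeVal x w (C.arg k₀ 0)) (C.nodeVal x w (C.arg k₀ 1)) = (C.nodeVal x w (.const c) ^^ false) := by
    intro x w; rw [op_eq_liveFn h₀, Bool.xor_false, hlive]; rfl
  -- the syntactic value of `k₀` is `c`
  have hsynk₀ : C.SynVal (.gate k₀) c := by
    obtain rfl | rfl : a₀ = 0 ∨ a₀ = 1 := by fin_cases a₀ <;> simp
    · refine .left (c := b₀) (h₀ ▸ .const b₀) fun q => ?_
      have := hlive q; unfold liveFn at this; rwa [if_pos rfl] at this
    · refine .right (c := b₀) (h₀ ▸ .const b₀) fun p => ?_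
      have := hlive p; unfold liveFn at this; rwa [if_neg (by decide)] at this
  have hsyn : ∀ b, C.SynVal (.gate k₀) b → b = c := fun b hb =>
    hb.unique hsynk₀ (by obtain ⟨w, hw, -⟩ := hF (fun _ => false); exact ⟨_, w, hw⟩)
  -- the construction of Rule 2
  have hv := C.redirectOK_const k₀ c
  let C₁ := C.redirect k₀ (.const c) false hv
  have hF₁ : C₁.Fair := hF.redirect hself hid
  have hC₁ : C₁.ComputesRestr f R := hC.redirect hself hid (fun i h => by cases h)
  have hPμ := C.measure_redirect_const' k₀ hk₀ c false αφ αI αQ hP R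
  have h0₁ : ∀ k a, C₁.arg k a ≠ .gate k₀ :=
    (fanout_eq_zero_iff _ _).mp (C.fanout_redirect_self k₀ _ false hv (fun h => by cases h))
  let ε := C₁.skipEquiv k₀
  have hex := C₁.exists_packing_removeGate_le k₀ ε h0₁ hPμ.1
  have hargs₁ : ∀ a, C₁.arg k₀ a = C.arg k₀ a := fun a => by
    show (if C.arg k₀ a = .gate k₀ then Node.const c else C.arg k₀ a) = _; rw [if_neg (hself a)]
  have hcost : C₁.delCost k₀ = 1 := by
    have : C₁.delCost k₀ = C.delCost k₀ := by unfold delCost; rw [hargs₁ 0, hargs₁ 1]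
    rw [this, C.delCost_of_const k₀ h₀]
  refine
    { C' := C₁.removeGate k₀ ε, P' := Classical.choose hex, fair := hF₁.removeGate ε h0₁,
      computes := hC₁.removeGate ε hF₁ h0₁ hout, packing := (Classical.choose_spec hex).1,
      m_add_one := C₁.removeGate_m_add_one k₀ ε, measure_le := ?_,
      ι := fun k => (ε k : Fin C.m), ι_injective := fun k k' h => ε.injective (Subtype.ext h),
      ι_ne := fun k => (ε k).2, ι_surj := fun k hk => ⟨ε.symm ⟨k, hk⟩, by simp [ε]⟩,
      constFed := fun k' ⟨a, b, h⟩ => ⟨a, b, ?_⟩,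
      trivReaders := fun _ k' ⟨a, h⟩ => ⟨a, c, ?_⟩,
      doomed_of := fun k' hk => C₁.mem_doomed_removeGate k₀ ε h0₁ (C.mem_doomed_redirect_const k₀ c hsyn hk),
      synVal_of := fun k' b h => ⟨b, ?_⟩,
      doomed_of_reads := fun b _ k' a hr =>
        C₁.mem_doomed_removeGate k₀ ε h0₁ (C.mem_doomed_redirect_const_of_reads k₀ c hr) }
  · have hpot : (C₁.removeGate k₀ ε).potential (Classical.choose hex) ≤ C₁.potential P + C₁.delCost k₀ :=
      (Classical.choose_spec hex).2
    have hinf : (((C₁.removeGate k₀ ε).influential R).card : ℝ) ≤ (C₁.influential R).card := by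
      exact_mod_cast card_le_card (C₁.influential_removeGate_subset k₀ ε h0₁ R)
    have hm : (((C.m - 1 : ℕ)) : ℝ) + 1 = C.m := by exact_mod_cast C₁.removeGate_m_add_one k₀ ε
    have hμ₁ : C₁.measure αφ αI αQ P R = C.measure αφ αI αQ P R := hPμ.2
    rw [← hμ₁]
    rw [hcost] at hpot
    unfold measure
    show ((C.m - 1 : ℕ) : ℝ) + _ + _ + _ ≤ _
    nlinarith [mul_le_mul_of_nonneg_left hinf hI, mul_le_mul_of_nonneg_left hpot hφ]
  · rw [removeGate_arg]
    show (if C.arg (ε k') a = .gate k₀ then Node.const c else C.arg (ε k') a).skip k₀ ε = .const b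
    rw [h, if_neg (fun h' => by cases h')]; rfl
  · rw [removeGate_arg]
    show (if C.arg (ε k') a = .gate k₀ then Node.const c else C.arg (ε k') a).skip k₀ ε = .const c
    rw [if_pos h]; rfl
  · have := (h.redirect_const C k₀ c hsyn).removeGate C₁ k₀ ε h0₁ (fun h' => (ε k').2 (Node.gate.inj h'))
    simpa [ε] using this

/-- **Elimination data (with doomed gates) for a degenerate gate that is not the output**
(Rule 3): `k₀` is fed by the constant `b₀` at `a₀` and passes its live input (negated iff
`neg`); its readers are rewired to the live input. [cite: LiYang2022, Lemma 3.11 (Rule 3)] -/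
noncomputable def elimDataDBypass (hF : C.Fair) (hC : C.ComputesRestr f R)
    {P : Finset (Fin C.m × Fin C.m)} (hP : C.IsPacking P) {a₀ : Fin 2} {b₀ : Bool} (neg : Bool)
    (h₀ : C.arg k₀ a₀ = .const b₀) (hdeg : ∀ t, C.liveFn k₀ a₀ b₀ t = (t ^^ neg)) (hout : C.out ≠ .gate k₀)
    (hφ : 0 ≤ αφ) (hI : 0 ≤ αI) (αQ : ℝ) : ElimDataD C k₀ f R αφ αI αQ P (1 - αφ) := by
  have hself := hF.not_reads_self_of_const h₀
  have hk₀ : ¬ C.Troubled k₀ := not_troubled_of_reads_const h₀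
  have hid : ∀ (x : Fin n → Bool) (w : Fin C.m → Bool),
      C.op k₀ (C.nodeVal x w (C.arg k₀ 0)) (C.nodeVal x w (C.arg k₀ 1)) =
        (C.nodeVal x w (C.arg k₀ a₀.rev) ^^ neg) := by
    intro x w; rw [op_eq_liveFn h₀, hdeg]
  let E := elimDataBypass a₀ neg hF hC hP hk₀ hself hid (Or.inr ⟨b₀, h₀⟩) hout hφ hI αQ
  let C₁ := C.redirect k₀ (C.arg k₀ a₀.rev) neg (C.redirectOK_live k₀ a₀)
  have h0₁ : ∀ k a, C₁.arg k a ≠ .gate k₀ := C.not_reads_redirect_live neg (hself _)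
  let ε := C.skipEquiv k₀
  refine
    { toElimData := E
      doomed_of := fun k' hk => ?_
      synVal_of := fun k' b h => ⟨b, ?_⟩
      doomed_of_reads := fun b hb k' a hr => ?_ }
  · show k' ∈ (C₁.removeGate k₀ ε).doomed
    exact C₁.mem_doomed_removeGate k₀ ε h0₁ (C.mem_doomed_redirect_live a₀ neg h₀ hdeg hk)
  · show (C₁.removeGate k₀ ε).SynVal (.gate k') b
    change C.SynVal (.gate (ε k' : Fin C.m)) b at h
    have := (SynVal.redirect_live C k₀ a₀ neg h₀ hdeg h).1.removeGate C₁ k₀ ε h0₁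
      (fun h' => (ε k').2 (Node.gate.inj h'))
    simpa [ε] using this
  · show k' ∈ (C₁.removeGate k₀ ε).doomed
    change C.arg (ε k' : Fin C.m) a = .gate k₀ at hr
    refine C₁.mem_doomed_removeGate k₀ ε h0₁ ((C₁.mem_doomed_iff).mpr ⟨a, b ^^ neg, ?_⟩)
    have harg : C₁.arg (ε k') a = if C.arg (ε k') a = .gate k₀ then C.arg k₀ a₀.rev else C.arg (ε k') a := rfl
    rw [harg, if_pos hr]
    exact (SynVal.redirect_live C k₀ a₀ neg h₀ hdeg hb).2 rfl

variable {d : ℕ}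

/-- **Elimination data (with doomed gates) for a gate fed by a constant** (Rules 2/3, output or
not), under the hypotheses of the one-step claim; `Δμ ≥ 1 - α_φ`. [cite: LiYang2022, Lemma 3.11 (Rules 2, 3)] -/
noncomputable def elimDataDConstFed (hf : IsAffineDisperser f d) (hd : 2 * d + 2 ≤ R.dim) (hF : C.Fair)
    (hC : C.ComputesRestr f R) {P : Finset (Fin C.m × Fin C.m)} (hP : C.IsPacking P)
    {a₀ : Fin 2} {b : Bool} (h₀ : C.arg k₀ a₀ = .const b)
    (hφ : 0 ≤ αφ) (hI : 0 ≤ αI) (αQ : ℝ) : ElimDataD C k₀ f R αφ αI αQ P (1 - αφ) := by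
  have hself := hF.not_reads_self_of_const h₀
  by_cases htriv : C.liveFn k₀ a₀ b false = C.liveFn k₀ a₀ b true
  · exact elimDataDTriv hF hC hP h₀ htriv (out_ne_of_trivialized hf (by omega) hF hC h₀ htriv) hφ hI αQ
  · have hdeg : ∀ t, C.liveFn k₀ a₀ b t = (t ^^ C.liveFn k₀ a₀ b false) :=
      (bool_fn_const_or_xor _).resolve_left htriv
    by_cases hout : C.out = .gate k₀
    · -- the output gate: its live input is a gate `k₁`
      cases hk₁ : C.arg k₀ a₀.rev with
      | const b' => exact absurd hout (out_ne_of_const_const hf (by omega) hF hC h₀ hk₁)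
      | var i => exact absurd hout (out_ne_of_live_var hf hd hF hC h₀ hk₁)
      | gate k₁ =>
      have hk : k₀ ≠ k₁ := fun h => hself a₀.rev (by rw [hk₁, h])
      cases hneg : C.liveFn k₀ a₀ b false with
      | false =>
        rw [hneg] at hdeg
        have hval : ∀ (x : Fin n → Bool) (w : Fin C.m → Bool), C.Consistent x w →
            C.nodeVal x w (C.arg k₀ a₀.rev) = C.nodeVal x w C.out := by
          intro x w hw
          rw [hout]
          show _ = w k₀
          rw [hw k₀, op_eq_liveFn h₀, hdeg, Bool.xor_false]
        exact ElimDataD.ofSetOut (v := C.arg k₀ a₀.rev)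
          (elimDataDBypass (C := C.setOut (C.arg k₀ a₀.rev)) (k₀ := k₀) hF.setOut (hC.setOut hval)
            ((C.isPacking_setOut_iff _ P).mpr hP) false h₀ hdeg (hself a₀.rev) hφ hI αQ)
      | true =>
        rw [hneg] at hdeg
        let C₂ := C.flipGate k₁
        have hF₂ : C₂.Fair := hF.flipGate
        have hC₂ : C₂.ComputesRestr f R := hC.flipGate (by rw [hout]; exact fun h => hk (Node.gate.inj h))
        have hP₂ : C₂.IsPacking P := (C.isPacking_flipGate_iff k₁ P).mpr hP
        have hdeg₂ : ∀ t, C₂.liveFn k₀ a₀ b t = (t ^^ false) := fun t => by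
          rw [C.liveFn_flipGate hk h₀, hk₁, decide_eq_true rfl, hdeg]
          cases t <;> rfl
        have hval : ∀ (x : Fin n → Bool) (w : Fin C.m → Bool), C₂.Consistent x w →
            C₂.nodeVal x w (C₂.arg k₀ a₀.rev) = C₂.nodeVal x w C₂.out := by
          intro x w hw
          show C₂.nodeVal x w (C.arg k₀ a₀.rev) = C₂.nodeVal x w C.out
          rw [hout]
          show _ = w k₀
          rw [hw k₀, op_eq_liveFn (C := C₂) h₀, hdeg₂, Bool.xor_false]
        refine ElimDataD.ofFlipGate (k₁ := k₁) (ElimDataD.ofSetOut (v := C.arg k₀ a₀.rev)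
          (elimDataDBypass (C := C₂.setOut (C.arg k₀ a₀.rev)) (k₀ := k₀) hF₂.setOut (hC₂.setOut hval)
            ((C₂.isPacking_setOut_iff _ P).mpr hP₂) false h₀ hdeg₂ (hself a₀.rev) hφ hI αQ)) hk
    · exact elimDataDBypass hF hC hP _ h₀ hdeg hout hφ hI αQ

/-! ### The generalized cascade -/

/-- **Generalized cascade of Rules 2/3** ("at least `r` gates are eliminated by Rule 2 and
Rule 3", Li–Yang §4.1, Cases 1, 3): under the hypotheses of the one-step claim, if at least `r`
gates are doomed, then `r` gates can be eliminated one after the other, each with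
`Δμ ≥ 1 - α_φ`, keeping fairness, `f|_R` and a packing. [cite: LiYang2022, §3.3, Lemma 3.11, §4.1 (Case 3)] -/
theorem cascade_doomed (hf : IsAffineDisperser f d) (hd : 2 * d + 2 ≤ R.dim) (hφ : 0 ≤ αφ) (hI : 0 ≤ αI)
    (αQ : ℝ) :
    ∀ (r : ℕ) (D : Semicircuit n) (P : Finset (Fin D.m × Fin D.m)), D.Fair → D.ComputesRestr f R →
      D.IsPacking P → r ≤ D.doomed.card →
      ∃ (D' : Semicircuit n) (P' : Finset (Fin D'.m × Fin D'.m)), D'.Fair ∧ D'.ComputesRestr f R ∧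
        D'.IsPacking P' ∧ D'.m + r = D.m ∧
        D'.measure αφ αI αQ P' R ≤ D.measure αφ αI αQ P R - r * (1 - αφ) := by
  classical
  intro r
  induction r with
  | zero =>
    intro D P hF hC hP _
    exact ⟨D, P, hF, hC, hP, by simp, by simp⟩
  | succ r ih =>
    intro D P hF hC hP hr
    -- pick a gate fed by a constant
    have hne : D.doomed.Nonempty := by rw [← card_pos]; omega
    have hcf := D.constFedCount_pos_of_doomed_nonempty hne
    obtain ⟨k₀, hk₀⟩ : (univ.filter fun k => ∃ a b, D.arg k a = .const b).Nonempty := by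
      rw [← card_pos]; exact hcf
    obtain ⟨a₀, b, h₀⟩ := (mem_filter.mp hk₀).2
    let E := elimDataDConstFed (C := D) (k₀ := k₀) hf hd hF hC hP h₀ hφ hI αQ
    have hcount : r ≤ E.C'.doomed.card := by
      have := E.card_doomed_le; omega
    obtain ⟨D', P', hF', hC', hP', hm, hμ⟩ := ih E.C' E.P' E.fair E.computes E.packing hcount
    refine ⟨D', P', hF', hC', hP', ?_, ?_⟩
    · have := E.m_add_one; omega
    · have := E.measure_le
      push_cast
      linarith

end Producers

end Semicircuit

end Literature.Computability.Complexity
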